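import Summits.NavierStokesRegularity.NavierStokesRegularity.Theorems.ExtremiserTransienceNearExtremalTransienceExtremiserLiouvilleConstantSpeedTools
import Summits.NavierStokesRegularity.NavierStokesRegularity.Theorems.ExtremiserTransienceNearExtremalTransienceExtremiserLiouvillePlateauTruncationLimits
import HarnessLib

/-!
# Crux `ExtremiserTransience.NearExtremalTransience` (stmt-NavierStokesRegularity-21883), line `extremiser_liouville`,
# stub K1b — A CONSTANT-SPEED EXTENDED EXTREMISER REVERSES AGAINST ITS FAR FIELD

`--supports stmt-NavierStokesRegularity-21883` (helper).  Author: prover seat `ns-el-k1b` (g2).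

`exists_inner_farField_nonpos_of_constSpeed_extremal`: let `v` be a smooth divergence-free field with CONSTANT speed
`‖v‖ ≡ M`, `‖Dv‖ ≤ B`, `Dv, D²v ∈ L²`, `0 < M√Z√W` and `|S(v)| = κ⋆·M√Z√W` (a constant-speed extended extremiser — by
`…ExtremiserLiouvillePlateau` this is all that remains of K1b).  Then its far-field value `c` (`‖c‖ = M`, `v → c` at
infinity) satisfies `⟪v(x), c⟫ ≤ 0` for some `x`: the field must somewhere turn at least a right angle away from its value
at infinity (equivalently `sup ‖v − c‖ ≥ √2·M`).

Proof.  Otherwise `⟪v, c⟫ ≥ δ₀ > 0` uniformly (continuity on a compact set + `v → c`).  Test the one-sided first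
variation (`ext_firstVariation_le_of_oneSided_normBound`) with the solenoidal truncations `Ψ_R` of `V := v − c`:
since `⟪v, V⟫ = ‖V‖²/2 = M² − ⟪v, c⟫ ≤ M² − δ₀` and `Ψ_R = χ_R V + O(sup_{‖x‖ ≥ R} ‖poincareField V‖)`, the norm
bound holds with `m = 1 − δ₀/(2M²)`; letting `R → ∞` (`tendsto_truncation_*`) gives `3S² ≤ (m + 2)S²`, i.e. `δ₀ ≤ 0`.

WHAT THIS IS NOT: a necessary condition on hypothetical constant-speed extremisers; it does not exclude them and
nothing here proves NS regularity. [folklore]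
-/

noncomputable section

open Set Filter Topology MeasureTheory Metric Function
open scoped ENNReal NNReal Topology InnerProductSpace RealInnerProductSpace ContDiff
open Literature.Analysis.FluidPDE Literature.Analysis

namespace Summit.NavierStokesRegularity.NavierStokesRegularity.Theorems

-- the problem directory repeats the summit name (`NavierStokesRegularity/NavierStokesRegularity`)
set_option linter.dupNamespace false

namespace ExtremiserLiouville

open DepletionLadder.KStar

variable {v : EuclideanSpace ℝ (Fin 3) → EuclideanSpace ℝ (Fin 3)}

/-- Norm bound for a one-sided perturbation: `‖a‖ = M`, `⟪a, u⟫ ≤ s`, `‖u‖ ≤ P`, `ε P² ≤ 2(mM² − s)`, `0 ≤ ε`,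
`0 ≤ 1 + mε` give `‖a + εu‖ ≤ (1 + mε)M`. [folklore] -/
theorem norm_add_smul_le_of_inner_le {a u : EuclideanSpace ℝ (Fin 3)} {M s P m ε : ℝ} (hM : ‖a‖ = M) (hM0 : 0 ≤ M)
    (hs : ⟪a, u⟫ ≤ s) (hP : ‖u‖ ≤ P) (hε : 0 ≤ ε) (hεP : ε * P ^ 2 ≤ 2 * (m * M ^ 2 - s)) (hm : 0 ≤ 1 + m * ε) :
    ‖a + ε • u‖ ≤ (1 + m * ε) * M := by
  have hsq : ‖a + ε • u‖ ^ 2 = M ^ 2 + 2 * ε * ⟪a, u⟫ + ε ^ 2 * ‖u‖ ^ 2 := by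
    rw [norm_add_sq_real, inner_smul_right, norm_smul, Real.norm_eq_abs, abs_of_nonneg hε, hM]; ring
  have hu2 : ‖u‖ ^ 2 ≤ P ^ 2 := pow_le_pow_left₀ (norm_nonneg _) hP 2
  have hle : ‖a + ε • u‖ ^ 2 ≤ ((1 + m * ε) * M) ^ 2 := by
    rw [hsq]
    nlinarith [mul_le_mul_of_nonneg_left hu2 (sq_nonneg ε), mul_le_mul_of_nonneg_left hs (by positivity : (0:ℝ) ≤ 2 * ε),
      mul_le_mul_of_nonneg_left hεP hε, sq_nonneg (m * ε * M)]
  exact (pow_le_pow_iff_left₀ (norm_nonneg _) (mul_nonneg hm hM0) two_ne_zero).1 hle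

/-- **One-sided norm bound along the truncations.**  If `‖v‖ ≡ M = ‖c‖`, `V = v − c → 0` at infinity and
`⟪v, c⟫ ≥ δ₀ > 0` uniformly, then for `R ≥ R₁` and `0 ≤ ε < ε₀`:
`‖v + ε Ψ_R‖ ≤ (1 + (1 − δ₀/(2M²)) ε)·M`, `Ψ_R := solenoidalTruncation V R`. [folklore] -/
theorem norm_add_smul_truncation_le {v V : EuclideanSpace ℝ (Fin 3) → EuclideanSpace ℝ (Fin 3)}
    {c : EuclideanSpace ℝ (Fin 3)} {M δ₀ : ℝ} (hMpos : 0 < M) (hM : ∀ x, ‖v x‖ = M)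
    (hV : ContDiff ℝ (⊤ : ℕ∞) V) (hVA : ∀ x, ‖V x‖ ≤ 2 * M)
    (hdec : Tendsto V (cocompact (EuclideanSpace ℝ (Fin 3))) (𝓝 0))
    (hvV : ∀ x, ⟪v x, V x⟫ = ‖V x‖ ^ 2 / 2) (hvc : ∀ x, ⟪v x, c⟫ = M ^ 2 - ‖V x‖ ^ 2 / 2)
    (hδ₀ : 0 < δ₀) (hδ₀M : δ₀ ≤ M ^ 2 / 2) (hmargin : ∀ x, δ₀ ≤ ⟪v x, c⟫) :
    ∃ R₁ ε₀ : ℝ, 0 < R₁ ∧ 0 < ε₀ ∧ ∀ R, R₁ ≤ R → ∀ ε : ℝ, 0 ≤ ε → ε < ε₀ → ∀ x,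
      ‖v x + ε • solenoidalTruncation V R x‖ ≤ (1 + (1 - δ₀ / (2 * M ^ 2)) * ε) * M := by
  have hM0 : 0 ≤ M := hMpos.le
  obtain ⟨K, hK0, hKb⟩ := exists_truncation_error_bounds
  -- the error level `δ` (kept opaque after its two properties are recorded)
  obtain ⟨δ, hδdef⟩ : ∃ δ : ℝ, δ = δ₀ / (4 * M * (K + 1)) := ⟨_, rfl⟩
  have hδ : 0 < δ := by rw [hδdef]; positivity
  have hKδ : M * (K * δ) ≤ δ₀ / 4 := by
    rw [hδdef, show M * (K * (δ₀ / (4 * M * (K + 1)))) = δ₀ / 4 * (K / (K + 1)) by field_simp]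
    exact mul_le_of_le_one_right (by positivity) ((div_le_one (by positivity)).2 (by linarith))
  obtain ⟨R₀, hR₀, hPF⟩ := exists_forall_norm_poincareField_le hVA hdec hδ
  have herr : ∀ R, max 1 R₀ ≤ R → ∀ x, ‖solenoidalTruncation V R x - cutoff R x • V x‖ ≤ K * δ := by
    intro R hR x
    refine (hKb V hV R ((le_max_left _ _).trans hR) x).1.trans (mul_le_mul_of_nonneg_left ?_ hK0)
    by_cases hx : x ∈ {x : EuclideanSpace ℝ (Fin 3) | R ≤ ‖x‖ ∧ ‖x‖ ≤ 2 * R}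
    · rw [indicator_of_mem hx]
      exact hPF x (((le_max_right _ _).trans hR).trans hx.1)
    · rw [indicator_of_notMem hx]; exact hδ.le
  -- alignment and size of `Ψ_R`
  have hinner : ∀ R, max 1 R₀ ≤ R → ∀ x, ⟪v x, solenoidalTruncation V R x⟫ ≤ M ^ 2 - 3 * δ₀ / 4 := by
    intro R hR x
    have hsplit : solenoidalTruncation V R x =
        cutoff R x • V x + (solenoidalTruncation V R x - cutoff R x • V x) := by abel
    rw [hsplit, inner_add_right, inner_smul_right, hvV x]
    have h1' : cutoff R x * (‖V x‖ ^ 2 / 2) ≤ ‖V x‖ ^ 2 / 2 :=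
      mul_le_of_le_one_left (by positivity) (cutoff_le_one R x)
    have h2' : ⟪v x, solenoidalTruncation V R x - cutoff R x • V x⟫ ≤ δ₀ / 4 := by
      refine (real_inner_le_norm _ _).trans ?_
      rw [hM x]
      exact (mul_le_mul_of_nonneg_left (herr R hR x) hM0).trans hKδ
    have h3' : ‖V x‖ ^ 2 / 2 ≤ M ^ 2 - δ₀ := by have := hmargin x; rw [hvc x] at this; linarith
    linarith
  have hsize : ∀ R, max 1 R₀ ≤ R → ∀ x, ‖solenoidalTruncation V R x‖ ≤ 2 * M + K * δ := by
    intro R hR x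
    have hsplit : solenoidalTruncation V R x =
        cutoff R x • V x + (solenoidalTruncation V R x - cutoff R x • V x) := by abel
    rw [hsplit]
    refine (norm_add_le _ _).trans (add_le_add ?_ (herr R hR x))
    rw [norm_smul, Real.norm_eq_abs]
    exact (mul_le_mul (abs_cutoff_le_one R x) (hVA x) (norm_nonneg _) zero_le_one).trans (by rw [one_mul])
  -- the bound
  have hP0 : 0 < (2 * M + K * δ) ^ 2 + 1 := by positivity
  refine ⟨max 1 R₀, δ₀ / 2 / ((2 * M + K * δ) ^ 2 + 1), lt_of_lt_of_le one_pos (le_max_left _ _), by positivity,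
    fun R hR ε hε0 hε x => ?_⟩
  have hm0 : 0 ≤ 1 + (1 - δ₀ / (2 * M ^ 2)) * ε := by
    have : δ₀ / (2 * M ^ 2) ≤ 1 := by rw [div_le_one (by positivity)]; nlinarith
    nlinarith
  refine norm_add_smul_le_of_inner_le (hM x) hM0 (hinner R hR x) (hsize R hR x) hε0 ?_ hm0
  have hε' : ε * (2 * M + K * δ) ^ 2 ≤ δ₀ / 2 := by
    have h := mul_le_mul_of_nonneg_right hε.le (sq_nonneg (2 * M + K * δ))
    refine h.trans ?_
    rw [div_mul_eq_mul_div, div_le_iff₀ hP0]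
    nlinarith [sq_nonneg (2 * M + K * δ)]
  have hmid : 2 * ((1 - δ₀ / (2 * M ^ 2)) * M ^ 2 - (M ^ 2 - 3 * δ₀ / 4)) = δ₀ / 2 := by
    field_simp
    ring
  rw [hmid]
  exact hε'

set_option maxHeartbeats 400000 in
/-- **A constant-speed extended extremiser reverses against its far field**: some `x` has `⟪v x, c⟫ ≤ 0`, where `c`
(`‖c‖ = M`) is the value of `v` at infinity. [folklore] -/
theorem exists_inner_farField_nonpos_of_constSpeed_extremal
    (hv : ContDiff ℝ ∞ v) (hdiv : VectorCalculus.IsDivFree v) {M B : ℝ}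
    (hM : ∀ x, ‖v x‖ = M) (hB : ∀ x, ‖fderiv ℝ v x‖ ≤ B)
    (h1 : ∫⁻ x, ‖iteratedFDeriv ℝ 1 v x‖ₑ ^ 2 < ⊤) (h2 : ∫⁻ x, ‖iteratedFDeriv ℝ 2 v x‖ₑ ^ 2 < ⊤)
    (hpos : 0 < M * Real.sqrt (∫ x, ‖curl v x‖ ^ 2) * Real.sqrt (∫ x, frobeniusNormSq (fderiv ℝ (curl v) x)))
    (hatt : |∫ x, ⟪curl v x, fderiv ℝ v x (curl v x)⟫| = (sInf {κ : ℝ | (∀ (v : EuclideanSpace ℝ (Fin 3) → EuclideanSpace ℝ (Fin 3)) (M B : ℝ), ContDiff ℝ (⊤ : ℕ∞) v → Literature.Analysis.FluidPDE.VectorCalculus.IsDivFree v → (∀ x, ‖v x‖ ≤ M) → (∀ x, ‖fderiv ℝ v x‖ ≤ B) → (∫⁻ x, ‖iteratedFDeriv ℝ 0 v x‖ₑ ^ 2 < ⊤) → (∫⁻ x, ‖iteratedFDeriv ℝ 1 v x‖ₑ ^ 2 < ⊤) → (∫⁻ x, ‖iteratedFDeriv ℝ 2 v x‖ₑ ^ 2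 < ⊤) → |∫ x, ⟪Literature.Analysis.FluidPDE.curl v x, fderiv ℝ v x (Literature.Analysis.FluidPDE.curl v x)⟫_ℝ| ≤ κ * M * Real.sqrt (∫ x, ‖Literature.Analysis.FluidPDE.curl v x‖ ^ 2) * Real.sqrt (∫ x, Literature.Analysis.FluidPDE.frobeniusNormSq (fderiv ℝ (Literature.Analysis.FluidPDE.curl v) x)))}) * M * Real.sqrt (∫ x, ‖curl v x‖ ^ 2) * Real.sqrt (∫ x, frobeniusNormSq (fderiv ℝ (curl v) x))) :
    ∃ c : EuclideanSpace ℝ (Fin 3), ‖c‖ = M ∧ Tendsto (fun x => v x - c) (cocompact (EuclideanSpace ℝ (Fin 3))) (𝓝 0) ∧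
      ∃ x, ⟪v x, c⟫ ≤ 0 := by
  have hK : 0 < (sInf {κ : ℝ | (∀ (v : EuclideanSpace ℝ (Fin 3) → EuclideanSpace ℝ (Fin 3)) (M B : ℝ), ContDiff ℝ (⊤ : ℕ∞) v → Literature.Analysis.FluidPDE.VectorCalculus.IsDivFree v → (∀ x, ‖v x‖ ≤ M) → (∀ x, ‖fderiv ℝ v x‖ ≤ B) → (∫⁻ x, ‖iteratedFDeriv ℝ 0 v x‖ₑ ^ 2 < ⊤) → (∫⁻ x, ‖iteratedFDeriv ℝ 1 v x‖ₑ ^ 2 < ⊤) → (∫⁻ x, ‖iteratedFDeriv ℝ 2 v x‖ₑ ^ 2 < ⊤) → |∫ x, ⟪Literature.Analysis.FluidPDE.curl v x, fderiv ℝ v x (Literature.Analysis.FluidPDE.curl v x)⟫_ℝ| ≤ κ * M * Real.sqrt (∫ x, ‖Literature.Analysis.FluidPDE.curl v x‖ ^ 2) * Real.sqrt (∫ x, Literature.Analysis.FluidPDE.frobeniusNormSq (fderiv ℝ (Literature.Analysis.FluidPDE.curl v) x)))}) := lt_trans (by norm_num) DepletionLadder.sharpDepletion_gt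
  have hM0 : 0 ≤ M := (norm_nonneg _).trans (hM 0).le
  have hZ0 : 0 ≤ ∫ x, ‖curl v x‖ ^ 2 := integral_nonneg fun x => sq_nonneg _
  have hW0 : 0 ≤ ∫ x, frobeniusNormSq (fderiv ℝ (curl v) x) := integral_nonneg fun x => frobeniusNormSq_nonneg _
  have hMpos : 0 < M := by
    rcases hM0.eq_or_lt with h | h
    · rw [← h, zero_mul, zero_mul] at hpos; exact absurd hpos (lt_irrefl _)
    · exact h
  have hSpos : 0 < |∫ x, ⟪curl v x, fderiv ℝ v x (curl v x)⟫| := by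
    rw [hatt, mul_assoc, mul_assoc]
    refine mul_pos hK ?_
    simpa [mul_assoc] using hpos
  have hS2 : (∫ x, ⟪curl v x, fderiv ℝ v x (curl v x)⟫) ^ 2 =
      (sInf {κ : ℝ | (∀ (v : EuclideanSpace ℝ (Fin 3) → EuclideanSpace ℝ (Fin 3)) (M B : ℝ), ContDiff ℝ (⊤ : ℕ∞) v → Literature.Analysis.FluidPDE.VectorCalculus.IsDivFree v → (∀ x, ‖v x‖ ≤ M) → (∀ x, ‖fderiv ℝ v x‖ ≤ B) → (∫⁻ x, ‖iteratedFDeriv ℝ 0 v x‖ₑ ^ 2 < ⊤) → (∫⁻ x, ‖iteratedFDeriv ℝ 1 v x‖ₑ ^ 2 < ⊤) → (∫⁻ x, ‖iteratedFDeriv ℝ 2 v x‖ₑ ^ 2 < ⊤) → |∫ x, ⟪Literature.Analysis.FluidPDE.curl v x, fderiv ℝ v x (Literature.Analysis.FluidPDE.curl v x)⟫_ℝ| ≤ κ * M * Real.sqrt (∫ x, ‖Literature.Analysis.FluidPDE.curl v x‖ ^ 2) * Real.sqrt (∫ x, Literature.Analysis.FluidPDE.frobeniusNormSq (fderiv ℝ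 (Literature.Analysis.FluidPDE.curl v) x)))}) ^ 2 * M ^ 2 * (∫ x, ‖curl v x‖ ^ 2) * (∫ x, frobeniusNormSq (fderiv ℝ (curl v) x)) := by
    rw [← sq_abs, hatt, mul_pow, mul_pow, mul_pow, Real.sq_sqrt hZ0, Real.sq_sqrt hW0]
  -- the far field
  have hv1 : ContDiff ℝ 1 v := contDiff_infty.1 hv 1
  have hD : ∫⁻ x, ‖fderiv ℝ v x‖ₑ ^ 2 < ⊤ := by
    refine lt_of_le_of_lt (le_of_eq (lintegral_congr fun x => ?_)) h1
    rw [(enorm_iteratedFDeriv_one_two v x).1]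
  obtain ⟨c, hcM, hdec, hmem, hid⟩ := exists_farField_of_constSpeed hv1 hM hB hD
  refine ⟨c, hcM, hdec, ?_⟩
  by_contra hno
  simp only [not_exists, not_le] at hno
  set V : EuclideanSpace ℝ (Fin 3) → EuclideanSpace ℝ (Fin 3) := fun x => v x - c with hVdef
  -- `⟪v x, c⟫ = M² − ‖V x‖²/2` and `⟪v x, V x⟫ = ‖V x‖²/2`
  have hvc : ∀ x, ⟪v x, c⟫ = M ^ 2 - ‖V x‖ ^ 2 / 2 := fun x => by
    have h := (hid x).1
    have hsplit : v x = c + V x := by simp [hVdef]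
    rw [hsplit, inner_add_left, real_inner_self_eq_norm_sq, hcM]
    show M ^ 2 + ⟪v x - c, c⟫ = M ^ 2 - ‖v x - c‖ ^ 2 / 2
    rw [h]; ring
  have hvV : ∀ x, ⟪v x, V x⟫ = ‖V x‖ ^ 2 / 2 := fun x => (hid x).2
  -- a uniform margin `δ₀`
  obtain ⟨δ₀, hδ₀, hδ₀M, hmargin⟩ : ∃ δ₀ : ℝ, 0 < δ₀ ∧ δ₀ ≤ M ^ 2 / 2 ∧ ∀ x, δ₀ ≤ ⟪v x, c⟫ := by
    have hev : ∀ᶠ x in cocompact (EuclideanSpace ℝ (Fin 3)), ‖V x‖ < M :=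
      (tendsto_zero_iff_norm_tendsto_zero.1 hdec).eventually (gt_mem_nhds hMpos)
    obtain ⟨K₀, hK₀, hK₀sub⟩ := mem_cocompact.1 hev
    have hfar : ∀ x, x ∉ K₀ → M ^ 2 / 2 ≤ ⟪v x, c⟫ := fun x hx => by
      have h : ‖V x‖ < M := hK₀sub hx
      rw [hvc x]
      nlinarith [norm_nonneg (V x)]
    rcases K₀.eq_empty_or_nonempty with hK₀e | hK₀n
    · exact ⟨M ^ 2 / 2, by positivity, le_rfl, fun x => hfar x (by simp [hK₀e])⟩
    · have hcont : Continuous fun x => ⟪v x, c⟫ := hv.continuous.inner continuous_const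
      obtain ⟨x₀, hx₀, hmin⟩ := hK₀.exists_isMinOn hK₀n hcont.continuousOn
      refine ⟨min (M ^ 2 / 2) ⟪v x₀, c⟫, lt_min (by positivity) (hno x₀), min_le_left _ _, fun x => ?_⟩
      by_cases hx : x ∈ K₀
      · exact (min_le_right _ _).trans (hmin hx)
      · exact (min_le_left _ _).trans (hfar x hx)
  -- data of `V`
  have hV : ContDiff ℝ (⊤ : ℕ∞) V := hv.sub contDiff_const
  have hV1 : ContDiff ℝ 1 V := contDiff_infty.1 hV 1
  have hVdiv : VectorCalculus.IsDivFree V := isDivFree_sub_const hdiv c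
  have hDV : fderiv ℝ V = fderiv ℝ v := funext fun y => fderiv_sub_const c
  have hcurlV : curl V = curl v := curl_sub_const_eq v c
  have hiter : ∀ n : ℕ, iteratedFDeriv ℝ (n + 1) V = iteratedFDeriv ℝ (n + 1) v := by
    intro n
    ext1 y
    rw [iteratedFDeriv_succ_eq_comp_right, iteratedFDeriv_succ_eq_comp_right]
    simp only [Function.comp, hVdef, fderiv_sub_const]
  have hD1V : ∫⁻ x, ‖iteratedFDeriv ℝ 1 V x‖ₑ ^ 2 < ⊤ := by rw [hiter 0]; exact h1
  have hD2V : ∫⁻ x, ‖iteratedFDeriv ℝ 2 V x‖ₑ ^ 2 < ⊤ := by rw [hiter 1]; exact h2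
  have hV6 : ∫⁻ x, ‖V x‖ₑ ^ 6 < ⊤ := by
    have h := lintegral_rpow_enorm_lt_top_of_eLpNorm_lt_top (by norm_num) (by norm_num) hmem.eLpNorm_lt_top
    simp only [ENNReal.toReal_ofNat] at h
    refine lt_of_le_of_lt (le_of_eq (lintegral_congr fun x => ?_)) h
    rw [show (6 : ℝ) = ((6 : ℕ) : ℝ) by norm_num, ENNReal.rpow_natCast]
  have hBV : ∀ y, ‖fderiv ℝ V y‖ ≤ B := fun y => by rw [hDV]; exact hB y
  have hVA : ∀ y, ‖V y‖ ≤ 2 * M := fun y => (norm_sub_le _ _).trans (by rw [hM y, hcM]; linarith)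
  -- the one-sided norm bound along the truncations, `m = 1 − δ₀/(2M²)`
  obtain ⟨R₁, ε₀, hR₁, hε₀, hbound⟩ :=
    norm_add_smul_truncation_le hMpos hM hV hVA hdec hvV hvc hδ₀ hδ₀M hmargin
  obtain ⟨m, hm⟩ : ∃ m : ℝ, m = 1 - δ₀ / (2 * M ^ 2) := ⟨_, rfl⟩
  rw [← hm] at hbound
  have hm1 : m < 1 := by
    have : 0 < δ₀ / (2 * M ^ 2) := by positivity
    rw [hm]; linarith
  have hvar : ∀ R, R₁ ≤ R →
      (∫ x, ⟪curl v x, fderiv ℝ v x (curl v x)⟫) * (∫ x, (⟪curl (solenoidalTruncation V R) x, fderiv ℝ v x (curl v x)⟫ + ⟪curl v x, fderiv ℝ (solenoidalTruncation V R) x (curl v x)⟫ + ⟪curl v x, fderiv ℝ v x (curl (solenoidalTruncation V R) x)⟫)) ≤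
      (sInf {κ : ℝ | (∀ (v : EuclideanSpace ℝ (Fin 3) → EuclideanSpace ℝ (Fin 3)) (M B : ℝ), ContDiff ℝ (⊤ : ℕ∞) v → Literature.Analysis.FluidPDE.VectorCalculus.IsDivFree v → (∀ x, ‖v x‖ ≤ M) → (∀ x, ‖fderiv ℝ v x‖ ≤ B) → (∫⁻ x, ‖iteratedFDeriv ℝ 0 v x‖ₑ ^ 2 < ⊤) → (∫⁻ x, ‖iteratedFDeriv ℝ 1 v x‖ₑ ^ 2 < ⊤) → (∫⁻ x, ‖iteratedFDeriv ℝ 2 v x‖ₑ ^ 2 < ⊤) → |∫ x, ⟪Literature.Analysis.FluidPDE.curl v x, fderiv ℝ v x (Literature.Analysis.FluidPDE.curl v x)⟫_ℝ| ≤ κ * M * Real.sqrt (∫ x, ‖Literature.Analysis.FluidPDE.curl v x‖ ^ 2) * Real.sqrt (∫ x, Literature.Analysis.FluidPDE.frobeniusNormSq (fderiv ℝ (Literature.Analysis.FluidPDE.curl v) x)))}) ^ 2 * M ^ 2 * (m * (∫ x, ‖curl v x‖ ^ 2) * (∫ x, frobeniusNormSq (fderiv ℝ (curl v) x)) + (∫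 x, frobeniusNormSq (fderiv ℝ (curl v) x)) * (∫ x, ⟪curl v x, curl (solenoidalTruncation V R) x⟫) + (∫ x, ‖curl v x‖ ^ 2) * (∫ x, ∑ i, ⟪fderiv ℝ (curl v) x (EuclideanSpace.basisFun (Fin 3) ℝ i), fderiv ℝ (curl (solenoidalTruncation V R)) x (EuclideanSpace.basisFun (Fin 3) ℝ i)⟫)) := by
    intro R hR
    exact ext_firstVariation_le_of_oneSided_normBound hv hdiv hB h1 h2 hatt (contDiff_solenoidalTruncation hV R)
      (hasCompactSupport_solenoidalTruncation (hR₁.trans_le hR))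
      (isDivFree_solenoidalTruncation finrank_euclideanSpace_fin hV1 hVdiv R) hε₀ (hbound R hR)
  -- pass to the limit `R → ∞`
  have hJ := tendsto_truncation_stretchingVariation hV hBV hV6 hD1V
  have hA := tendsto_truncation_enstrophyVariation hV hV6 hD1V
  have hC := tendsto_truncation_palinstrophyVariation hV hV6 hD1V hD2V
  rw [hcurlV, hDV] at hJ
  rw [hcurlV] at hA hC
  have hlhs := hJ.const_mul (∫ x, ⟪curl v x, fderiv ℝ v x (curl v x)⟫)
  have hrhs := ((tendsto_const_nhds (x := m * (∫ x, ‖curl v x‖ ^ 2) * (∫ x, frobeniusNormSq (fderiv ℝ (curl v) x)))).add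
    ((hA.const_mul (∫ x, frobeniusNormSq (fderiv ℝ (curl v) x))).add
      (hC.const_mul (∫ x, ‖curl v x‖ ^ 2)))).const_mul ((sInf {κ : ℝ | (∀ (v : EuclideanSpace ℝ (Fin 3) → EuclideanSpace ℝ (Fin 3)) (M B : ℝ), ContDiff ℝ (⊤ : ℕ∞) v → Literature.Analysis.FluidPDE.VectorCalculus.IsDivFree v → (∀ x, ‖v x‖ ≤ M) → (∀ x, ‖fderiv ℝ v x‖ ≤ B) → (∫⁻ x, ‖iteratedFDeriv ℝ 0 v x‖ₑ ^ 2 < ⊤) → (∫⁻ x, ‖iteratedFDeriv ℝ 1 v x‖ₑ ^ 2 < ⊤) → (∫⁻ x, ‖iteratedFDeriv ℝ 2 v x‖ₑ ^ 2 < ⊤) → |∫ x, ⟪Literature.Analysis.FluidPDE.curl v x, fderiv ℝ v x (Literature.Analysis.FluidPDE.curl v x)⟫_ℝ| ≤ κ * M * Real.sqrt (∫ x, ‖Literature.Analysis.FluidPDE.curl v x‖ ^ 2) * Real.sqrt (∫ x, Literature.Analysis.FluidPDE.frobeniusNormSq (fderiv ℝ (Literature.Analysis.FluidPDE.curl v)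 x)))}) ^ 2 * M ^ 2)
  have hev : ∀ᶠ R in atTop,
      (∫ x, ⟪curl v x, fderiv ℝ v x (curl v x)⟫) * (∫ x, (⟪curl (solenoidalTruncation V R) x, fderiv ℝ v x (curl v x)⟫ + ⟪curl v x, fderiv ℝ (solenoidalTruncation V R) x (curl v x)⟫ + ⟪curl v x, fderiv ℝ v x (curl (solenoidalTruncation V R) x)⟫)) ≤
      (sInf {κ : ℝ | (∀ (v : EuclideanSpace ℝ (Fin 3) → EuclideanSpace ℝ (Fin 3)) (M B : ℝ), ContDiff ℝ (⊤ : ℕ∞) v → Literature.Analysis.FluidPDE.VectorCalculus.IsDivFree v → (∀ x, ‖v x‖ ≤ M) → (∀ x, ‖fderiv ℝ v x‖ ≤ B) → (∫⁻ x, ‖iteratedFDeriv ℝ 0 v x‖ₑ ^ 2 < ⊤) → (∫⁻ x, ‖iteratedFDeriv ℝ 1 v x‖ₑ ^ 2 < ⊤) → (∫⁻ x, ‖iteratedFDeriv ℝ 2 v x‖ₑ ^ 2 < ⊤) → |∫ x, ⟪Literature.Analysis.FluidPDE.curl v x, fderiv ℝ v x (Literature.Analysis.FluidPDE.curl v x)⟫_ℝ|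 ≤ κ * M * Real.sqrt (∫ x, ‖Literature.Analysis.FluidPDE.curl v x‖ ^ 2) * Real.sqrt (∫ x, Literature.Analysis.FluidPDE.frobeniusNormSq (fderiv ℝ (Literature.Analysis.FluidPDE.curl v) x)))}) ^ 2 * M ^ 2 * (m * (∫ x, ‖curl v x‖ ^ 2) * (∫ x, frobeniusNormSq (fderiv ℝ (curl v) x)) + ((∫ x, frobeniusNormSq (fderiv ℝ (curl v) x)) * (∫ x, ⟪curl v x, curl (solenoidalTruncation V R) x⟫) + (∫ x, ‖curl v x‖ ^ 2) * (∫ x, ∑ i, ⟪fderiv ℝ (curl v) x (EuclideanSpace.basisFun (Fin 3) ℝ i), fderiv ℝ (curl (solenoidalTruncation V R)) x (EuclideanSpace.basisFun (Fin 3) ℝ i)⟫))) :=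
    (eventually_ge_atTop R₁).mono fun R hR => by have h := hvar R hR; rw [add_assoc] at h; exact h
  have hL := le_of_tendsto_of_tendsto hlhs hrhs hev
  -- `3 S² ≤ (m + 2) S²` with `S² = κ⋆² M² Z W > 0` and `m = 1 − δ₀/(2M²) < 1`
  have hT : 0 < (∫ x, ⟪curl v x, fderiv ℝ v x (curl v x)⟫) ^ 2 := by
    have h := pow_pos hSpos 2; rwa [sq_abs] at h
  nlinarith [hL, hS2, hT, hm1]

end ExtremiserLiouville

end Summit.NavierStokesRegularity.NavierStokesRegularity.Theorems

end
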